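import Literature.AlgebraicGeometry.Resolution.AbhyankarResidueSeparability
import Literature.AlgebraicGeometry.Resolution.GeneralizedStabilityHolds
import Literature.AlgebraicGeometry.Resolution.SubfieldTransport
import Summits.ResolutionOfSingularities.ResolutionOfSingularities.Theorems.ValuativeLuAlphaPTorsorAbhyankarDefectless
import Mathlib.FieldTheory.Perfect
import Mathlib.FieldTheory.IsAlgClosed.AlgebraicClosure
import HarnessLib

/-!
# The Frobenius twist of an Abhyankar function field has separably generated reduction
# (crux `Valuative.LuAlphaPTorsor`, stmt-ResolutionOfSingularities-0641, stub `stub_frobeniusTwistSeparable`)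

Crux `Valuative.LuAlphaPTorsor` (item `stmt-ResolutionOfSingularities-0641`), line
`pfaff-line-log-final-forms`, registered stub `stub_frobeniusTwistSeparable` (S1).

Setting: `k` a field of characteristic `p` (possibly IMPERFECT), `K ⊇ k` finitely generated,
`O ⊇ k` a valuation ring of `K` which is an Abhyankar place of `K/k`
(`IsAbhyankarPlace O (im k) ⊤`).

**Claim.** For some `e`, the residue field of the subfield `K_e := k(K^{p^e}) ⊆ K` (with respect
to `O ∩ K_e`) is separably generated over the residue field of `k`.

Proof (Temkin 2013, Thm. 5.5.3, PROVED in the tree, plus a Frobenius twist). Work in an algebraic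
closure `Ω ⊇ K` with an extension `V` of `O` (Chevalley), the ambient Abhyankar system `(x, y)`
of `K/k` read off the Abhyankar place (Knaf–Kuhlmann 2005, Thm. 2.1,
`exists_abhyankarData_of_isAbhyankarPlace`) and generators `T` of `K/k`. By
`exists_separablyGenerated_level` (from Kuhlmann's generalized stability theorem,
`Kuhlmann2010Stability_holds`) there is a finite `C ⊆ k^{1/p^∞}` such that for every level
`C ⊆ S ⊆ k^{1/p^∞}` the residue field of `M_S = k(S, x, y, T)` is separably generated over that of
`k(S)`. Take `e` with `C^{p^e} ⊆ k` and the (infinite) level `S₀ := {z : z^{p^e} ∈ k}`. The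
automorphism `Frob^e` of the perfect field `Ω` maps `V` onto `V`, `k(S₀) = S₀` onto `k` and
`M_{S₀}` onto `k·K^{p^e} = K_e`, and induces `Frob^e` on the residue field of `V`; separable
generation is transported along it (`separablyGeneratedOver_map`) and finally pulled back from
`(Ω, V)` to `(K, O)` along the embedding of residue fields `residueFieldHom K V`.
-/

-- single-problem summit: the doubled namespace component `ResolutionOfSingularities` is forced
set_option linter.dupNamespace false

noncomputable section

namespace Summit.ResolutionOfSingularities.ResolutionOfSingularities.Theorems.PfaffLine

open IsLocalRing ValuationSubring IntermediateField Literature.AlgebraicGeometry.Resolution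

universe u

/-! ### Transport lemmas -/

/-- **Separable generation descends along a field embedding**: if `θ : L → L'` is a homomorphism
of fields and `θ(F)` is separably generated over `θ(K')`, then `F` is separably generated over
`K'` (pull the separating transcendence basis back along the isomorphisms `K' ≃ θ(K')`,
`K'(t) ≃ θ(K')(θ t)`). The converse of `separablyGeneratedOver_map`. [folklore] -/
theorem separablyGeneratedOver_of_map {L L' : Type*} [Field L] [Field L'] (θ : L →+* L')
    {K' F : Subfield L} (h : SeparablyGeneratedOver (K'.map θ) (F.map θ)) :
    SeparablyGeneratedOver K' F := by
  classical
  obtain ⟨t', ht'F, hind, hsep⟩ := h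
  have ht'θ : (t' : Set L') ⊆ Set.range θ := fun a ha => by
    obtain ⟨z, -, rfl⟩ := Subfield.mem_map.mp (ht'F ha)
    exact ⟨z, rfl⟩
  let t : Finset L := t'.preimage θ θ.injective.injOn
  have htt' : θ '' (t : Set L) = t' := by
    rw [Finset.coe_preimage, Set.image_preimage_eq_of_subset ht'θ]
  obtain ⟨eK, heK⟩ := exists_ringEquiv_map θ K'
  obtain ⟨eA, heA⟩ := exists_ringEquiv_adjoin_map θ K' (t : Set L)
  refine ⟨t, fun z hz => ?_, ?_, fun z hz => ?_⟩
  · obtain ⟨w, hw, hwz⟩ := Subfield.mem_map.mp (ht'F (Finset.mem_preimage.mp hz))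
    rwa [← θ.injective hwz]
  · refine (algebraicIndependent_ringHom_iff_of_comp_eq eK θ θ.injective
      (RingHom.ext fun w => heK w)).mp ?_
    let σ : t → t' := fun w => ⟨θ w, Finset.mem_preimage.mp w.2⟩
    have hσ : Function.Injective σ := fun a b hab =>
      Subtype.ext (θ.injective (congrArg Subtype.val hab))
    exact hind.comp σ hσ
  · letI : Algebra (IntermediateField.adjoin K' (t : Set L)) L' :=
      (θ.comp (algebraMap (IntermediateField.adjoin K' (t : Set L)) L)).toAlgebra
    let θa : L →ₐ[IntermediateField.adjoin K' (t : Set L)] L' := { θ with commutes' := fun _ => rfl }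
    have h1 : IsSeparable (IntermediateField.adjoin (K'.map θ) (θ '' (t : Set L))) (θ z) := by
      rw [htt']
      exact hsep (θ z) (Subfield.mem_map.mpr ⟨z, hz, rfl⟩)
    have hcomp : (algebraMap (IntermediateField.adjoin K' (t : Set L)) L').comp
        (eA.symm : _ →+* IntermediateField.adjoin K' (t : Set L)) =
        algebraMap (IntermediateField.adjoin (K'.map θ) (θ '' (t : Set L))) L' := by
      ext d
      change θ ((eA.symm d : IntermediateField.adjoin K' (t : Set L)) : L) = (d : L')
      rw [← heA, RingEquiv.apply_symm_apply]
    have h2 : IsSeparable (IntermediateField.adjoin K' (t : Set L)) (θa z) :=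
      isSeparable_of_ringHom_comp_eq (eA.symm : _ →+* _) hcomp h1
    exact IsSeparable.of_algHom θa h2

/-- **Residue fields of subfields along `K → Ω`**: for a valuation ring `V` of `Ω ⊇ K` and a
subfield `E ⊆ K`, the embedding of residue fields `K̃ → Ṽ` (`K̃` the residue field of
`V ∩ K`) maps the residue field of `E` onto the residue field of the image of `E` in `Ω`.
[folklore] -/
theorem map_resField_residueFieldHom {K Ω : Type u} [Field K] [Field Ω] [Algebra K Ω]
    (V : ValuationSubring Ω) (E : Subfield K) :
    (resField (V.comap (algebraMap K Ω)) E).map (residueFieldHom K V) =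
      resField V (E.map (algebraMap K Ω)) := by
  ext r
  rw [Subfield.mem_map, mem_resField_iff]
  constructor
  · rintro ⟨s, hs, rfl⟩
    obtain ⟨a, haE, rfl⟩ := (mem_resField_iff _ E s).mp hs
    refine ⟨comapSubringHom K V a, Subfield.mem_map.mpr ⟨a, haE, rfl⟩, ?_⟩
    rw [residueFieldHom_residue]
  · rintro ⟨b, hb, rfl⟩
    obtain ⟨a, haE, hab⟩ := Subfield.mem_map.mp hb
    have haV : a ∈ V.comap (algebraMap K Ω) := by
      rw [ValuationSubring.mem_comap, hab]; exact b.2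
    refine ⟨residue _ ⟨a, haV⟩, residue_mem_resField _ ⟨a, haV⟩ haE, ?_⟩
    rw [residueFieldHom_residue]
    congr 1
    exact Subtype.ext hab

/-- **Residue fields of subfields under Frobenius**: if `Fr = Frob^e` on `Ω` (`Fr z = z^{p^e}`),
then for a valuation ring `V` of `Ω` and a subfield `E ⊆ Ω` the residue field of `Fr(E)` is the
image of the residue field of `E` under `Frob^e` of the residue field (`z ∈ V ↔ z^{p^e} ∈ V`, and
residues commute with powers). [folklore] -/
theorem map_resField_frobenius {Ω : Type*} [Field Ω] (p e : ℕ) (V : ValuationSubring Ω)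
    [ExpChar (ResidueField V) p] (Fr : Ω →+* Ω) (hFr : ∀ z, Fr z = z ^ p ^ e) (E : Subfield Ω) :
    (resField V E).map (iterateFrobenius (ResidueField V) p e) = resField V (E.map Fr) := by
  ext r
  rw [Subfield.mem_map, mem_resField_iff]
  constructor
  · rintro ⟨s, hs, rfl⟩
    obtain ⟨a, haE, rfl⟩ := (mem_resField_iff V E s).mp hs
    refine ⟨a ^ p ^ e, Subfield.mem_map.mpr ⟨a, haE, ?_⟩, ?_⟩
    · rw [hFr]; push_cast; rfl
    · rw [iterateFrobenius_def, map_pow]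
  · rintro ⟨b, hb, rfl⟩
    obtain ⟨a, haE, hab⟩ := Subfield.mem_map.mp hb
    rw [hFr] at hab
    have haV : a ∈ V := by
      rw [mem_valuationSubring_iff_pow_mem V a (expChar_pow_pos (ResidueField V) p e).ne', hab]
      exact b.2
    refine ⟨residue V ⟨a, haV⟩, residue_mem_resField V ⟨a, haV⟩ haE, ?_⟩
    rw [iterateFrobenius_def, ← map_pow]
    congr 1
    exact Subtype.ext hab

/-! ### The stub -/

/-- **The Frobenius twist `K_e = k(K^{p^e})` of a finitely generated Abhyankar valued function
field has, for `e ≫ 0`, a residue field separably generated over that of `k`** (Temkin 2013,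
Thm. 5.5.3, twisted by `Frob^e`): inside an algebraic closure `Ω ⊇ K` with an extension `V` of
`O`, the level `S₀ = {z : z^{p^e} ∈ k} ⊇ C` of `exists_separablyGenerated_level` has
`M_{S₀} = k^{1/p^e} K` with residue field separably generated over that of `k(S₀) = k^{1/p^e}`;
`Frob^e` maps `V` onto `V`, `k^{1/p^e}` onto `k` and `M_{S₀}` onto `K_e`, inducing `Frob^e` on
the residue field, and the statement is pulled back to `K` along `residueFieldHom K V`.
[cite: Temkin2013, Thm. 5.5.3 (p. 61 of arXiv:0804.1554v3)] -/
theorem stub_frobeniusTwistSeparable :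
    ∀ p : ℕ, p.Prime → ∀ (k K : Type) [Field k] [CharP k p] [Field K] [Algebra k K] (O : ValuationSubring K), (∀ c : k, algebraMap k K c ∈ O) → (⊤ : IntermediateField k K).FG → Literature.AlgebraicGeometry.Resolution.IsAbhyankarPlace O (algebraMap k K).fieldRange ⊤ → ∃ e : ℕ, Literature.AlgebraicGeometry.Resolution.SeparablyGeneratedOver (Literature.AlgebraicGeometry.Resolution.resField O (algebraMap k K).fieldRange) (Literature.AlgebraicGeometry.Resolution.resField O (IntermediateField.adjoin k (Set.range fun z : K => z ^ p ^ e)).toSubfield) := by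
  intro p hp k K _ _ _ _ O hk hfg hA
  classical
  haveI : Fact p.Prime := ⟨hp⟩
  -- ambient closure and an extension of the valuation ring (Chevalley)
  let Ω : Type := AlgebraicClosure K
  obtain ⟨V, hV⟩ := exists_valuationSubring_comap_eq (Ω := Ω) O
  subst hV
  have hkV : ∀ c : k, algebraMap k Ω c ∈ V := fun c => by
    have h := hk c
    rwa [ValuationSubring.mem_comap, ← IsScalarTower.algebraMap_apply] at h
  letI := algebraOfMem k (V.comap (algebraMap K Ω)) hk
  haveI := isScalarTower_algebraOfMem k (V.comap (algebraMap K Ω)) hk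
  -- Abhyankar data of `K/k` (Knaf–Kuhlmann 2005, Thm. 2.1)
  obtain ⟨E, F, xK, yK, hxv, hyK, hBasis⟩ :=
    exists_abhyankarData_of_isAbhyankarPlace (V.comap (algebraMap K Ω)) hk hA
  have hxK0 : ∀ j, xK j ≠ 0 := hxv.1
  haveI hfinK := finiteDimensional_adjoin_of_isTranscendenceBasis hfg _ hBasis
  -- the ambient Abhyankar system
  let x : Fin E → Ω := fun j => algebraMap K Ω (xK j)
  let y : Fin F → Ω := fun i => algebraMap K Ω (yK i : K)
  have hx0 : ∀ j, x j ≠ 0 := fun j => (map_ne_zero _).mpr (hxK0 j)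
  have hymem : ∀ i, y i ∈ V := fun i => (yK i).2
  have hB : IsAmbientAbhyankarSystem V hkV x y := by
    refine { ne_zero := hx0, mem := hymem, linearIndependent := ?_, algebraicIndependent := ?_ }
    · rw [linearIndependent_valuation_iff V x hx0]
      intro s g hg
      refine hxv.2 s g ?_
      rw [valuation_comap_eq_one_iff V]
      have hcoe : algebraMap K Ω (∏ j ∈ s, xK j ^ g j) = ∏ j ∈ s, x j ^ g j := by
        rw [map_prod]
        exact Finset.prod_congr rfl fun j _ => map_zpow₀ _ _ _
      rw [hcoe]
      exact hg
    · letI := algebraOfMem k V hkV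
      have h := AlgebraicIndependent.ringHom_of_comp_eq (RingHom.id k)
        (residueFieldHom K V) hyK Function.surjective_id (residueFieldHom K V).injective (by
          ext c
          change residueFieldHom K V (residue _ (algebraMap k (V.comap (algebraMap K Ω)) c)) =
            residue V (algebraMap k V c)
          rw [residueFieldHom_residue]
          congr 1)
      convert h using 1
      funext i
      simp only [Function.comp_apply]
      rw [residueFieldHom_residue]
      rfl
  -- generators of `K/k`
  obtain ⟨gK, hgK⟩ := hfg
  let T : Finset Ω := gK.image (algebraMap K Ω)
  -- the image of `K` is contained in `k(T)`
  have hKT : ∀ a : K, algebraMap K Ω a ∈ adjoin k (T : Set Ω) := by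
    intro a
    have ha : a ∈ adjoin k (gK : Set K) := by rw [hgK]; exact mem_top
    have ha' : (IsScalarTower.toAlgHom k K Ω) a ∈ (adjoin k (gK : Set K)).map
        (IsScalarTower.toAlgHom k K Ω) := ⟨a, ha, rfl⟩
    rw [adjoin_map] at ha'
    have himg : (IsScalarTower.toAlgHom k K Ω) '' (gK : Set K) = (T : Set Ω) := by
      simp only [T, Finset.coe_image]; rfl
    rw [himg] at ha'
    exact ha'
  have hT : ∀ t ∈ T, IsIntegral (levL k x y (∅ : Set Ω)) t := by
    intro t ht
    obtain ⟨g, -, rfl⟩ := Finset.mem_image.mp ht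
    rw [isIntegral_levL_iff]
    have hg : IsIntegral (adjoin k (Set.range (Sum.elim xK fun i => (yK i : K)))) g :=
      Algebra.IsIntegral.isIntegral g
    have hmem : ∀ a : adjoin k (Set.range (Sum.elim xK fun i => (yK i : K))),
        algebraMap K Ω (a : K) ∈ Lk k x y (∅ : Set Ω) := by
      intro a
      have ha' : (IsScalarTower.toAlgHom k K Ω) (a : K) ∈
          (adjoin k (Set.range (Sum.elim xK fun i => (yK i : K)))).map
            (IsScalarTower.toAlgHom k K Ω) := ⟨a, a.2, rfl⟩
      rw [adjoin_map] at ha'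
      refine adjoin.mono k _ _ ?_ ha'
      rintro _ ⟨_, ⟨(j | i), rfl⟩, rfl⟩
      · exact Or.inr (Or.inr ⟨j, rfl⟩)
      · exact Or.inr (Or.inl ⟨i, rfl⟩)
    let ρ : adjoin k (Set.range (Sum.elim xK fun i => (yK i : K))) →+* Lk k x y (∅ : Set Ω) :=
      RingHom.codRestrict ((algebraMap K Ω).comp (algebraMap _ K)) (Lk k x y (∅ : Set Ω)) hmem
    exact hg.map_of_comp_eq ρ (algebraMap K Ω) (RingHom.ext fun a => rfl)
  -- separable generation at large levels (Temkin 2013, Thm. 5.5.3)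
  obtain ⟨C, hCP, hC⟩ := exists_separablyGenerated_level (T := T) Kuhlmann2010Stability_holds hB hT
  -- the exponent `e`: `c ^ p ^ e ∈ k` for every `c ∈ C`
  have hCe : ∀ c ∈ C, ∃ n : ℕ, c ^ p ^ n ∈ (algebraMap k Ω).range := fun c hc =>
    (mem_perfectClosure_iff_pow_mem p).mp (hCP hc)
  choose! nC hnC using hCe
  let e : ℕ := C.sup nC
  have hCe' : ∀ c ∈ C, c ^ p ^ e ∈ (algebraMap k Ω).range := by
    intro c hc
    have hle : nC c ≤ e := Finset.le_sup hc
    obtain ⟨a, ha⟩ := hnC c hc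
    refine ⟨a ^ p ^ (e - nC c), ?_⟩
    rw [map_pow, ha, ← pow_mul, ← pow_add, Nat.add_sub_cancel' hle]
  refine ⟨e, ?_⟩
  -- the Frobenius `Fr = Frob^e` of the perfect field `Ω`
  haveI : CharP K p := charP_of_injective_algebraMap (algebraMap k K).injective p
  haveI : CharP Ω p := charP_of_injective_algebraMap (algebraMap K Ω).injective p
  obtain ⟨Fr, hFr, hFrsurj⟩ : ∃ Fr : Ω →+* Ω, (∀ z, Fr z = z ^ p ^ e) ∧ Function.Surjective Fr :=
    ⟨iterateFrobenius Ω p e, fun z => rfl, (bijective_iterateFrobenius Ω p e).2⟩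
  -- the level `S₀ = Fr⁻¹(k)`
  set kΩ : Subfield Ω := (algebraMap k Ω).fieldRange with hkΩ
  set S₀ : Set Ω := {z | z ^ p ^ e ∈ (algebraMap k Ω).range} with hS₀
  have hmemS₀ : ∀ z : Ω, z ∈ S₀ ↔ Fr z ∈ kΩ := fun z => by
    simp only [hS₀, Set.mem_setOf_eq, RingHom.mem_range, hkΩ, RingHom.mem_fieldRange, hFr]
  have hkS₀ : ∀ c : k, algebraMap k Ω c ∈ S₀ := fun c => ⟨c ^ p ^ e, by rw [map_pow]⟩
  have hCS₀ : (C : Set Ω) ⊆ S₀ := fun c hc => hCe' c hc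
  have hS₀P : S₀ ⊆ PSet k Ω := fun z hz => (mem_perfectClosure_iff_pow_mem p).mpr ⟨e, hz⟩
  obtain ⟨s, hsRS, hind, hsep⟩ := hC S₀ hCS₀ hS₀P
  have hSG : SeparablyGeneratedOver (resField V (lS k S₀).toSubfield)
      (resField V (Mk k x y T S₀).toSubfield) := ⟨s, hsRS, hind, hsep⟩
  -- `Fr (k(S₀)) = k`
  have hlS : (lS k S₀).toSubfield.map Fr = kΩ := by
    apply le_antisymm
    · refine Subfield.map_le_iff_le_comap.mpr ?_
      show (adjoin k S₀).toSubfield ≤ kΩ.comap Fr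
      rw [adjoin_toSubfield]
      refine Subfield.closure_le.mpr ?_
      rintro z (⟨c, rfl⟩ | hz)
      · exact (hmemS₀ _).mp (hkS₀ c)
      · exact (hmemS₀ _).mp hz
    · intro w hw
      obtain ⟨z, rfl⟩ := hFrsurj w
      exact Subfield.mem_map.mpr ⟨z, subset_adjoin k S₀ ((hmemS₀ z).mpr hw), rfl⟩
  -- `Fr (M_{S₀}) = K_e`
  set Ke : IntermediateField k K := adjoin k (Set.range fun z : K => z ^ p ^ e) with hKe
  set KeΩ : Subfield Ω := Ke.toSubfield.map (algebraMap K Ω) with hKeΩ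
  have hpow_mem : ∀ a : K, Fr (algebraMap K Ω a) ∈ KeΩ := fun a => by
    refine Subfield.mem_map.mpr ⟨a ^ p ^ e, subset_adjoin k _ ⟨a, rfl⟩, ?_⟩
    rw [map_pow, hFr]
  have hkKe : ∀ c : k, algebraMap k Ω c ∈ KeΩ := fun c =>
    Subfield.mem_map.mpr ⟨algebraMap k K c, Ke.algebraMap_mem c,
      (IsScalarTower.algebraMap_apply k K Ω c).symm⟩
  have hKT' : ∀ a : K, algebraMap K Ω a ∈ Mk k x y T S₀ := fun a =>
    adjoin.mono k _ _ (fun t ht => Or.inr ht) (hKT a)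
  have hMk : (Mk k x y T S₀).toSubfield.map Fr = KeΩ := by
    apply le_antisymm
    · refine Subfield.map_le_iff_le_comap.mpr ?_
      show (adjoin k (S₀ ∪ abhSet x y ∪ ↑T)).toSubfield ≤ KeΩ.comap Fr
      rw [adjoin_toSubfield]
      refine Subfield.closure_le.mpr ?_
      rintro z (⟨c, rfl⟩ | (hz | hz) | hz)
      · show Fr (algebraMap k Ω c) ∈ KeΩ
        rw [hFr, ← map_pow]
        exact hkKe _
      · show Fr z ∈ KeΩ
        obtain ⟨c, hc⟩ := (hmemS₀ z).mp hz
        rw [← hc]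
        exact hkKe c
      · show Fr z ∈ KeΩ
        rcases hz with ⟨i, rfl⟩ | ⟨j, rfl⟩
        · exact hpow_mem _
        · exact hpow_mem _
      · show Fr z ∈ KeΩ
        obtain ⟨g, -, rfl⟩ := Finset.mem_image.mp hz
        exact hpow_mem _
    · have hk'' : ∀ c : k, algebraMap k K c ∈
          ((Mk k x y T S₀).toSubfield.map Fr).comap (algebraMap K Ω) := by
        intro c
        rw [Subfield.mem_comap, ← IsScalarTower.algebraMap_apply]
        obtain ⟨z, hz⟩ := hFrsurj (algebraMap k Ω c)
        exact Subfield.mem_map.mpr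
          ⟨z, lS_le_Mk S₀ (subset_adjoin k S₀ ((hmemS₀ z).mpr ⟨c, hz.symm⟩)), hz⟩
      have hle : Ke ≤ (((Mk k x y T S₀).toSubfield.map Fr).comap
          (algebraMap K Ω)).toIntermediateField hk'' := by
        refine adjoin_le_iff.mpr ?_
        rintro _ ⟨a, rfl⟩
        show algebraMap K Ω (a ^ p ^ e) ∈ (Mk k x y T S₀).toSubfield.map Fr
        rw [map_pow, ← hFr]
        exact Subfield.mem_map.mpr ⟨_, hKT' a, rfl⟩
      rintro w hw
      obtain ⟨a, ha, rfl⟩ := Subfield.mem_map.mp hw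
      exact hle ha
  have hk'eq : ((algebraMap k K).fieldRange).map (algebraMap K Ω) = kΩ := by
    rw [hkΩ, RingHom.map_fieldRange, ← IsScalarTower.algebraMap_eq]
  -- transport along `Frob^e` of the residue field, then back to `K`
  letI := algebraOfMem k V hkV
  haveI : ExpChar (ResidueField V) p :=
    expChar_of_injective_ringHom (algebraMap k (ResidueField V)).injective p
  have hSG' := separablyGeneratedOver_map (iterateFrobenius (ResidueField V) p e) hSG
  rw [map_resField_frobenius p e V Fr hFr, map_resField_frobenius p e V Fr hFr, hlS, hMk,
    ← hk'eq, hKeΩ, ← map_resField_residueFieldHom, ← map_resField_residueFieldHom] at hSG'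
  exact separablyGeneratedOver_of_map _ hSG'

end Summit.ResolutionOfSingularities.ResolutionOfSingularities.Theorems.PfaffLine

end
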